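import Literature.NumberTheory.GaloisRepresentations.InertiaCohomologyTorsionBound
import Literature.NumberTheory.GaloisRepresentations.ContinuousCohomologyAdditiveTransport
import Literature.NumberTheory.EllipticCurves.SelmerCocycleLiftUnramifiedFiniteProofs
import Literature.NumberTheory.IwasawaTheory.Greenberg2006.CofiniteGenerationCriterion
import Mathlib.NumberTheory.Padics.RingHoms
import HarnessLib

/-!
# Crux 4 `BSDpOnCellC` (stmt-BirchSwinnertonDyer-19034), line «telescope» v10, leaf N2|pub sub-leaf W2 / leaf N3′ — the (ann) input, fifth brick:
# `H¹(I_F, D)^∨` IS FINITELY GENERATED over `Λ_X = ℤ_p⟦X⟧` for a discrete `Λ_X`-representation `D` killed by `X`, `p`-primary,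
# with `H¹(I_F, D)[p]` finite
# (successor LEAD `cruxlead-19034` g3; `--supports`, helper; THEOREMS ONLY; generic over a non-archimedean local field `F`; closes no registered stub)

HONEST FRAMING. No registered stub, no crux, no summit statement is proved; BSD is proved for no curve. Greenberg's criterion
(`Greenberg2006.isCofinitelyGenerated_of_finite_torsionBy_maximalIdeal`: `𝔪`-power torsion + `S[𝔪]` finite ⇒ cofinitely generated, over
`Λ ≅ ℤ_p⟦T_1,…,T_m⟧`) applied to `H¹(I_F, D)` with `Λ_X = ℤ_p⟦X⟧`-coefficients; the `𝔪`-torsion is controlled by the `p`-torsion of the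
SAME
group computed with `ℤ`-coefficients (`continuousCohomologyAddEquiv`: the standard complex does not see the scalars), which is the output of
`TelescopeK2HOneInertiaQuasiIso.finite_setOf_smul_eq_zero_h1_absInertia_of_hom`.

* `maximalIdeal_le_span_sup_span` — `𝔪_{ℤ_p⟦X⟧} ≤ (p) ⊔ (X)`.
* **`module_finite_characterModule_h1_absInertia`** — `ρ : Γ_F → Aut_{Λ_X}(D)` discrete, `X • D = 0`, `D` `p`-primary,
  `H¹(I_F, D|_ℤ)[p]` finite ⇒ `Module.Finite Λ_X (H¹(I_F, D)^∨)`.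

References: R. Greenberg, in: Doc. Math. Extra Vol. Coates (2006) §3 A, Prop. 3.1–3.2 [Greenberg2006]; J.-P. Serre, Cohomologie galoisienne,
I §2.2 [SerreGaloisCohomology1997].
-/

set_option autoImplicit false
set_option linter.dupNamespace false

noncomputable section

open CategoryTheory Function
open scoped Pointwise Valued
open Field ValuativeRel IsLocalRing

universe u

open Literature.NumberTheory.GaloisRepresentations Literature.NumberTheory.GaloisRepresentations.IsNonarchimedeanLocalField
  Literature.NumberTheory.IwasawaTheory.Greenberg2006

namespace Summit.BirchSwinnertonDyer.BirchSwinnertonDyer.Theorems.TelescopeK2HOneInertiaCofinite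

/-- `𝔪_{ℤ_p⟦X⟧} ≤ (p) + (X)`: a non-unit power series has non-unit constant coefficient, i.e. one divisible by `p`. [folklore] -/
theorem maximalIdeal_le_span_sup_span {p : ℕ} [Fact p.Prime] :
    maximalIdeal (PowerSeries ℤ_[p]) ≤
      Ideal.span {((p : ℕ) : PowerSeries ℤ_[p])} ⊔ Ideal.span {(PowerSeries.X : PowerSeries ℤ_[p])} := by
  intro f hf
  rw [mem_maximalIdeal, mem_nonunits_iff, PowerSeries.isUnit_iff_constantCoeff] at hf
  have h0 : PowerSeries.constantCoeff f ∈ maximalIdeal ℤ_[p] := hf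
  rw [PadicInt.maximalIdeal_eq_span_p, Ideal.mem_span_singleton] at h0
  obtain ⟨u, hu⟩ := h0
  have hdecomp : f = PowerSeries.C (PowerSeries.constantCoeff f) +
      PowerSeries.X * PowerSeries.mk fun n => PowerSeries.coeff (n + 1) f := by
    rw [add_comm]
    exact (PowerSeries.eq_X_mul_shift_add_const f)
  rw [hdecomp]
  refine Ideal.add_mem _ (Ideal.mem_sup_left ?_) (Ideal.mem_sup_right ?_)
  · rw [hu, map_mul, map_natCast]
    exact Ideal.mul_mem_right _ _ (Ideal.subset_span rfl)
  · exact Ideal.mul_mem_right _ _ (Ideal.subset_span rfl)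

variable {F : Type} [Field F] [ValuativeRel F] [TopologicalSpace F] [IsNonarchimedeanLocalField F]

/-- **`H¹(I_F, D)^∨` is finitely generated over `ℤ_p⟦X⟧`.** `D` a discrete continuous `Γ_F`-representation over `ℤ_p⟦X⟧` killed by `X`
and `p`-primary, whose inertia cohomology with `ℤ`-coefficients has finite `p`-torsion. [cite: Greenberg2006, §3 A (proof of Prop. 3.2)]
[cite: SerreGaloisCohomology1997, I §2.2] -/
theorem module_finite_characterModule_h1_absInertia {p : ℕ} [Fact p.Prime] {m : ℕ}
    (e : PowerSeries ℤ_[p] ≃+* MvPowerSeries (Fin m) ℤ_[p])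
    [TopologicalSpace (PowerSeries ℤ_[p])]
    {D : Type} [AddCommGroup D] [Module (PowerSeries ℤ_[p]) D] [TopologicalSpace D] [DiscreteTopology D]
    [ContinuousSMul (PowerSeries ℤ_[p]) D]
    (ρ : ContinuousRep (absoluteGaloisGroup F) (PowerSeries ℤ_[p]) D)
    (ρZ : ContinuousRep (absoluteGaloisGroup F) ℤ D) (hρZ : ∀ (g : absoluteGaloisGroup F) (x : D), ρZ g x = ρ g x)
    (hX : ∀ d : D, (PowerSeries.X : PowerSeries ℤ_[p]) • d = 0) (hp : ∀ d : D, ∃ k : ℕ, p ^ k • d = 0)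
    (hfin : Finite (Submodule.torsionBy ℤ
      (continuousCohomology 1 ((ρZ.restrict (subgroupIncl (absInertia F))).toTopRep)) (p : ℤ))) :
    Module.Finite (PowerSeries ℤ_[p])
      (CharacterModule (continuousCohomology 1 ((ρ.restrict (subgroupIncl (absInertia F))).toTopRep))) := by
  classical
  haveI : CompactSpace (absoluteGaloisGroup F) := absoluteGaloisGroup_compactSpace F
  haveI : CompactSpace (absInertia F) :=
    isCompact_iff_compactSpace.mp (isClosed_absInertia_holds F).isCompact
  set XS := (ρ.restrict (subgroupIncl (absInertia F))).toTopRep with hXS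
  set XZ := (ρZ.restrict (subgroupIncl (absInertia F))).toTopRep with hXZ
  -- the cohomology groups with `ℤ_p⟦X⟧`- and with `ℤ`-coefficients agree additively
  let η : (XS : Type) ≃ₜ+ (XZ : Type) := ContinuousAddEquiv.refl D
  have hη : ∀ (g : absInertia F) (x : XS), η (XS.ρ g x) = XZ.ρ g (η x) := fun g x => (hρZ _ x).symm
  let e₁ : (continuousCohomology 1 XS : Type) ≃+ (continuousCohomology 1 XZ : Type) := continuousCohomologyAddEquiv η hη 1
  -- every class is killed by `X` and by a power of `p`
  have hXH : ∀ c : continuousCohomology 1 XS, (PowerSeries.X : PowerSeries ℤ_[p]) • c = 0 := by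
    intro c
    obtain ⟨z, rfl⟩ := oneCocycleClass_surjective _ c
    exact Literature.NumberTheory.EllipticCurves.BigGaloisRep.oneCocycleClass_smul_eq_zero_of_forall _ _ z fun g => hX _
  have hpD : ∀ d : (XS : Type), ∃ k : ℕ, ((p : ℕ) : PowerSeries ℤ_[p]) ^ k • d = 0 := fun d => by
    obtain ⟨k, hk⟩ := hp d
    exact ⟨k, by rw [← Nat.cast_pow, Nat.cast_smul_eq_nsmul]; exact hk⟩
  have hpH : ∀ c : continuousCohomology 1 XS, ∃ k : ℕ, ((p : ℕ) : PowerSeries ℤ_[p]) ^ k • c = 0 :=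
    fun c => Literature.NumberTheory.EllipticCurves.BigGaloisRep.exists_pow_smul_eq_zero XS _ hpD c
  -- `𝔪`-power torsion
  have htors : ∀ c : continuousCohomology 1 XS, ∃ k : ℕ, ∀ r ∈ maximalIdeal (PowerSeries ℤ_[p]) ^ k, r • c = 0 := by
    intro c
    obtain ⟨k, hk⟩ := hpH c
    refine ⟨k + 1, fun r hr => ?_⟩
    have hle := Ideal.pow_right_mono (maximalIdeal_le_span_sup_span (p := p)) (k + 1)
    have hr' := Ideal.sup_pow_add_le_pow_sup_pow (hle hr)
    rw [Ideal.span_singleton_pow, pow_one] at hr'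
    obtain ⟨a, ha, b, hb, rfl⟩ := Submodule.mem_sup.1 hr'
    obtain ⟨s, rfl⟩ := Ideal.mem_span_singleton'.1 ha
    obtain ⟨t, rfl⟩ := Ideal.mem_span_singleton'.1 hb
    rw [add_smul, mul_smul, hk, smul_zero, mul_smul, hXH, smul_zero, add_zero]
  -- `H¹[𝔪]` is finite: it lies in `H¹[p]`, which injects into the finite `p`-torsion of the `ℤ`-coefficient cohomology
  haveI := hfin
  have hpfin : Set.Finite {c : continuousCohomology 1 XS | ((p : ℕ) : PowerSeries ℤ_[p]) • c = 0} := by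
    refine Set.Finite.of_injOn (f := fun c => e₁ c) (fun c hc => ?_) (e₁.injective.injOn) (Set.toFinite
      ((Submodule.torsionBy ℤ (continuousCohomology 1 XZ) (p : ℤ) : Submodule ℤ (continuousCohomology 1 XZ)) :
        Set (continuousCohomology 1 XZ)))
    rw [Set.mem_setOf_eq, Nat.cast_smul_eq_nsmul] at hc
    rw [SetLike.mem_coe, Submodule.mem_torsionBy_iff, Nat.cast_smul_eq_nsmul, ← map_nsmul, hc, map_zero]
  haveI : Finite (Submodule.torsionBySet (PowerSeries ℤ_[p]) (continuousCohomology 1 XS)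
      (maximalIdeal (PowerSeries ℤ_[p]) : Set (PowerSeries ℤ_[p]))) := by
    refine Set.finite_coe_iff.mpr (hpfin.subset fun c hc => ?_)
    rw [SetLike.mem_coe, Submodule.mem_torsionBySet_iff] at hc
    have hpm : ((p : ℕ) : PowerSeries ℤ_[p]) ∈ (maximalIdeal (PowerSeries ℤ_[p]) : Set (PowerSeries ℤ_[p])) := by
      rw [SetLike.mem_coe, mem_maximalIdeal, mem_nonunits_iff, PowerSeries.isUnit_iff_constantCoeff, map_natCast]
      intro h
      exact (PadicInt.norm_lt_one_iff_dvd _ |>.mpr (dvd_refl (p : ℤ_[p])) |>.ne) (PadicInt.isUnit_iff.mp h)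
    exact hc ⟨_, hpm⟩
  exact isCofinitelyGenerated_iff_module_finite_characterModule.mp
    (isCofinitelyGenerated_of_finite_torsionBy_maximalIdeal e htors)

end Summit.BirchSwinnertonDyer.BirchSwinnertonDyer.Theorems.TelescopeK2HOneInertiaCofinite

end
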